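import Summits.Ventures.PercRepro.S1CFGTrianglesTwo

/-!
# PercRepro — TOOLS FOR THE TRIANGLE CAP AT EVERY `n ≥ ν + 3` (p1, gen 40)

The series-pair half of S1CFGTrianglesAll (the `400`-line rule): for a simple coloop-free matroid
`M` (`|E| = n = rk E + ν`, no dependent pair) with a SERIES PAIR `e ≠ f`, i.e. `f ∉ cl (E ∖ {e, f})`:
* `notMem_closure_sdiff_pair_symm` — a series pair is symmetric (`rk (E ∖ e) = rk (E ∖ f) = rk E`);
* `ncard_three_eRk_le_two_mem_le_one` — AT MOST ONE rank-`≤ 2` triple contains `e` (every such triple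
  contains `f`; two of them, `{e, f, x}` and `{e, f, y}`, give the rank-`≤ 2` triple `{e, x, y}` avoiding `f`);
* `ncard_three_eRk_le_two_le_sdiff_add` — the count of rank-`2` triples split at a point;
* `ncard_three_eRk_le_two_sdiff_le_choose` — the crude landed cap on `E ∖ {e}`: `c₃(E ∖ e) ≤ C(ν + 1, 3)`
  (nullity `ν − 1`; no coloop-freeness of the restriction needed).
Together: with a series pair, `c₃ ≤ C(ν + 1, 3) + 1` for EVERY `n` (assembled in S1CFGTrianglesAll).
Nothing about any cell is claimed. Axioms: standard.
-/

open scoped Matroid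

namespace PercRepro

namespace S1CFG

open Set S1CF

variable {α : Type}

/-- `insert f (E ∖ {e, f}) = E ∖ {e}` for `f ∈ E`, `e ≠ f`. -/
theorem insert_sdiff_pair_eq_sdiff_singleton {E : Set α} {e f : α} (hf : f ∈ E) (hef : e ≠ f) :
    insert f (E \ {e, f}) = E \ {e} := by
  ext x
  simp only [mem_insert_iff, mem_sdiff, mem_singleton_iff, not_or]
  constructor
  · rintro (rfl | ⟨hx, hxe, _⟩)
    · exact ⟨hf, fun h => hef h.symm⟩
    · exact ⟨hx, hxe⟩
  · rintro ⟨hx, hxe⟩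
    by_cases hxf : x = f
    · exact Or.inl hxf
    · exact Or.inr ⟨hx, hxe, hxf⟩

/-- `(E ∖ {e}) ∖ {f} = E ∖ {e, f}`. -/
theorem sdiff_singleton_sdiff_singleton_eq {E : Set α} (e f : α) : (E \ {e}) \ {f} = E \ {e, f} := by
  ext x
  simp only [mem_sdiff, mem_singleton_iff, mem_insert_iff, not_or]
  tauto

/-- A series pair is symmetric: in a coloop-free matroid, if `f ∉ cl (E ∖ {e, f})` (`e ≠ f` in `E`) then
`e ∉ cl (E ∖ {e, f})` (`rk (E ∖ e) = rk (E ∖ f) = rk E`). -/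
theorem notMem_closure_sdiff_pair_symm (M : Matroid α) [M.Finite] (hK : ∀ e, ¬ M.IsColoop e)
    {e f : α} (he : e ∈ M.E) (hf : f ∈ M.E) (hef : e ≠ f) (h : f ∉ M.closure (M.E \ {e, f})) :
    e ∉ M.closure (M.E \ {e, f}) := by
  intro he'
  have h1 : M.eRk (insert f (M.E \ {e, f})) = M.eRk (M.E \ {e, f}) + 1 :=
    Matroid.eRk_insert_eq_add_one ⟨hf, h⟩
  have h2 : M.eRk (insert e (M.E \ {e, f})) = M.eRk (M.E \ {e, f}) := by
    rw [← M.eRk_closure_eq (insert e _), Matroid.closure_insert_eq_of_mem_closure he', M.eRk_closure_eq]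
  have hins_f : insert f (M.E \ {e, f}) = M.E \ {e} := insert_sdiff_pair_eq_sdiff_singleton hf hef
  have hins_e : insert e (M.E \ {e, f}) = M.E \ {f} := by
    rw [Set.pair_comm]
    exact insert_sdiff_pair_eq_sdiff_singleton he hef.symm
  rw [hins_f, eRk_sdiff_singleton_eq_of_not_isColoop M he (hK e)] at h1
  rw [hins_e, eRk_sdiff_singleton_eq_of_not_isColoop M hf (hK f)] at h2
  obtain ⟨r, hr⟩ : ∃ r : ℕ, M.eRk (M.E \ {e, f}) = r := ⟨_, (S1.coe_toNat_eRk M sdiff_subset).symm⟩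
  rw [hr] at h1 h2
  rw [h2] at h1
  have : (r : ℕ∞) + 1 ≠ r := by
    intro hc
    have hc' : (r + 1 : ℕ) = r := by exact_mod_cast hc
    omega
  exact this h1.symm

/-- **AT MOST ONE TRIANGLE THROUGH A SERIES-PAIR POINT**: in a simple coloop-free matroid with `e ≠ f` in `E`
and `f ∉ cl (E ∖ {e, f})`, at most one rank-`≤ 2` triple contains `e` (every such triple contains `f`,
and two of them would give a rank-`≤ 2` triple through `e` avoiding `f`). -/
theorem ncard_three_eRk_le_two_mem_le_one (M : Matroid α) [M.Finite] (hK : ∀ e, ¬ M.IsColoop e)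
    (h0 : {P : Set α | P ⊆ M.E ∧ P.ncard = 2 ∧ M.Dep P}.ncard = 0) {e f : α} (he : e ∈ M.E)
    (hf : f ∈ M.E) (hef : e ≠ f) (h : f ∉ M.closure (M.E \ {e, f})) :
    {X : Set α | X ⊆ M.E ∧ X.ncard = 3 ∧ M.eRk X ≤ 2 ∧ e ∈ X}.ncard ≤ 1 := by
  have hEfin := M.ground_finite
  have he' := notMem_closure_sdiff_pair_symm M hK he hf hef h
  -- every rank-`2` triple through `e` contains `f`
  have hmemf : ∀ X, X ⊆ M.E → X.ncard = 3 → M.eRk X ≤ 2 → e ∈ X → f ∈ X := by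
    intro X hXE hX3 hXr heX
    by_contra hfX
    have hP : X \ {e} ⊆ M.E \ {e, f} := by
      intro x hx
      refine ⟨hXE hx.1, ?_⟩
      simp only [mem_insert_iff, mem_singleton_iff, not_or]
      exact ⟨hx.2, fun hxf => hfX (hxf ▸ hx.1)⟩
    have hP2 : (X \ {e}).ncard = 2 := by
      rw [Set.ncard_sdiff_singleton_of_mem heX, hX3]
    have hPE : X \ {e} ⊆ M.E := hP.trans sdiff_subset
    have hPind := indep_of_ncard_eq_two_of_no_dep_pair M h0 hPE hP2
    have hXe : insert e (X \ {e}) = X := by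
      rw [insert_sdiff_singleton, insert_eq_of_mem heX]
    have hecl : e ∈ M.closure (X \ {e}) :=
      mem_closure_pair_of_eRk_insert_le_two M hPE hPind hP2 he (by rw [hXe]; exact hXr)
    exact he' (M.closure_subset_closure hP hecl)
  have hefind : M.Indep {e, f} :=
    indep_of_ncard_eq_two_of_no_dep_pair M h0 (pair_subset he hf) (ncard_pair hef)
  -- every rank-`2` triple through `e` and `f` lies in `cl {e, f}`
  have hsub : ∀ Z, Z ⊆ M.E → M.eRk Z ≤ 2 → e ∈ Z → f ∈ Z → Z ⊆ M.closure {e, f} := by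
    intro Z hZE hZr heZ hfZ x hxZ
    apply mem_closure_pair_of_eRk_insert_le_two M (pair_subset he hf) hefind (ncard_pair hef) (hZE hxZ)
    exact (M.eRk_mono (insert_subset hxZ (pair_subset heZ hfZ))).trans hZr
  have hfam : {X : Set α | X ⊆ M.E ∧ X.ncard = 3 ∧ M.eRk X ≤ 2 ∧ e ∈ X}.Finite :=
    hEfin.finite_subsets.subset (fun X hX => hX.1)
  rw [Set.ncard_le_one_iff hfam]
  intro X Y hX hY
  obtain ⟨hXE, hX3, hXr, heX⟩ := hX
  obtain ⟨hYE, hY3, hYr, heY⟩ := hY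
  have hfX := hmemf X hXE hX3 hXr heX
  have hfY := hmemf Y hYE hY3 hYr heY
  -- a third point of each
  have hthird : ∀ Z : Set α, Z.ncard = 3 → e ∈ Z → f ∈ Z → ∃ x, x ∈ Z ∧ x ≠ e ∧ x ≠ f := by
    intro Z hZ3 heZ hfZ
    by_contra hcon
    push Not at hcon
    have hZsub : Z ⊆ {e, f} := by
      intro x hx
      rcases eq_or_ne x e with hxe | hxe
      · exact hxe ▸ mem_insert e {f}
      · rw [hcon x hx hxe]
        exact mem_insert_of_mem e (mem_singleton f)
    have := Set.ncard_le_ncard hZsub (toFinite _)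
    rw [ncard_pair hef] at this
    omega
  obtain ⟨x, hxX, hxe, hxf⟩ := hthird X hX3 heX hfX
  obtain ⟨y, hyY, hye, hyf⟩ := hthird Y hY3 heY hfY
  have hX' : X = {e, f, x} := by
    symm
    apply Set.eq_of_subset_of_ncard_le
    · exact insert_subset heX (insert_subset hfX (singleton_subset_iff.mpr hxX))
    · rw [hX3, Set.ncard_eq_three.mpr ⟨e, f, x, hef, hxe.symm, hxf.symm, rfl⟩]
    · exact hEfin.subset hXE
  have hY' : Y = {e, f, y} := by
    symm
    apply Set.eq_of_subset_of_ncard_le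
    · exact insert_subset heY (insert_subset hfY (singleton_subset_iff.mpr hyY))
    · rw [hY3, Set.ncard_eq_three.mpr ⟨e, f, y, hef, hye.symm, hyf.symm, rfl⟩]
    · exact hEfin.subset hYE
  by_cases hxy : x = y
  · rw [hX', hY', hxy]
  · exfalso
    -- `{e, x, y}` is a rank-`≤ 2` triple through `e` avoiding `f`
    have hexy_sub : ({e, x, y} : Set α) ⊆ M.closure {e, f} := by
      intro z hz
      rcases hz with rfl | rfl | rfl
      · exact M.mem_closure_of_mem' (mem_insert z {f}) he
      · exact hsub X hXE hXr heX hfX hxX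
      · exact hsub Y hYE hYr heY hfY hyY
    have hexy_r : M.eRk {e, x, y} ≤ 2 := by
      calc M.eRk {e, x, y} ≤ M.eRk (M.closure {e, f}) := M.eRk_mono hexy_sub
        _ = M.eRk {e, f} := M.eRk_closure_eq _
        _ = 2 := by rw [hefind.eRk_eq_encard, encard_pair hef]
    have hexy_3 : ({e, x, y} : Set α).ncard = 3 :=
      Set.ncard_eq_three.mpr ⟨e, x, y, hxe.symm, hye.symm, hxy, rfl⟩
    have hexy_E : ({e, x, y} : Set α) ⊆ M.E :=
      insert_subset he (insert_subset (hXE hxX) (singleton_subset_iff.mpr (hYE hyY)))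
    have hfin := hmemf {e, x, y} hexy_E hexy_3 hexy_r (mem_insert e _)
    rcases hfin with hfe | hfx | hfy
    · exact hef hfe.symm
    · exact hxf hfx.symm
    · exact hyf (mem_singleton_iff.mp hfy).symm

/-- The count of rank-`2` triples, split at a point `e`: those avoiding `e` plus those through `e`. -/
theorem ncard_three_eRk_le_two_le_sdiff_add (M : Matroid α) [M.Finite] (e : α) :
    {X : Set α | X ⊆ M.E ∧ X.ncard = 3 ∧ M.eRk X ≤ 2}.ncard ≤
      {X : Set α | X ⊆ M.E \ {e} ∧ X.ncard = 3 ∧ M.eRk X ≤ 2}.ncard +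
      {X : Set α | X ⊆ M.E ∧ X.ncard = 3 ∧ M.eRk X ≤ 2 ∧ e ∈ X}.ncard := by
  have hEfin := M.ground_finite
  have hsub : {X : Set α | X ⊆ M.E ∧ X.ncard = 3 ∧ M.eRk X ≤ 2} ⊆
      {X : Set α | X ⊆ M.E \ {e} ∧ X.ncard = 3 ∧ M.eRk X ≤ 2} ∪
      {X : Set α | X ⊆ M.E ∧ X.ncard = 3 ∧ M.eRk X ≤ 2 ∧ e ∈ X} := by
    intro X hX
    obtain ⟨hXE, hX3, hXr⟩ := hX
    by_cases heX : e ∈ X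
    · exact Or.inr ⟨hXE, hX3, hXr, heX⟩
    · left
      refine ⟨fun x hx => ⟨hXE hx, fun hxe => heX ?_⟩, hX3, hXr⟩
      rw [mem_singleton_iff.mp hxe] at hx
      exact hx
  refine (Set.ncard_le_ncard hsub ?_).trans (Set.ncard_union_le _ _)
  exact (hEfin.finite_subsets.subset (fun X hX => hX.1.trans sdiff_subset)).union
    (hEfin.finite_subsets.subset (fun X hX => hX.1))

/-- The crude landed cap on `E ∖ {e}` (`e` not a coloop, nullity `ν − 1`): `c₃(E ∖ e) ≤ C(ν + 1, 3)`. -/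
theorem ncard_three_eRk_le_two_sdiff_le_choose (M : Matroid α) [M.Finite] {ν : ℕ}
    (hd : M.E.encard = M.eRank + (ν : ℕ∞)) (hK : ∀ e, ¬ M.IsColoop e)
    (h0 : {P : Set α | P ⊆ M.E ∧ P.ncard = 2 ∧ M.Dep P}.ncard = 0) {e : α} (he : e ∈ M.E) (hν : 1 ≤ ν) :
    {X : Set α | X ⊆ M.E \ {e} ∧ X.ncard = 3 ∧ M.eRk X ≤ 2}.ncard ≤ (ν + 1).choose 3 := by
  have hcap := ncard_three_eRk_le_two_le_of_no_dep_pair_restrict M h0 (sdiff_subset : M.E \ {e} ⊆ M.E)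
  have hrk : M.eRk (M.E \ {e}) = M.eRk M.E := eRk_sdiff_singleton_eq_of_not_isColoop M he (hK e)
  have hnE := ncard_ground_eq_eRk_toNat_add M hd
  have hcard : (M.E \ {e}).ncard = M.E.ncard - 1 := Set.ncard_sdiff_singleton_of_mem he
  rw [hrk] at hcap
  have hval : (M.E \ {e}).ncard - (M.eRk M.E).toNat + 2 = ν + 1 := by omega
  rw [hval] at hcap
  exact hcap

end S1CFG

end PercRepro
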